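import Summits.CriticalPhenomena.PercolationContinuityZ3.Theorems.Transplant.PlanarCells2VDefs
import HarnessLib

/-!
# N2 (frames-only node, OPEN) — (F) column under (R-44)(c)/(R-48), DISCHARGE LAYER part 1W: **THE BAND ROWS OF THE ONE-SIDED FACE FLOORS FROM THREE NODE ROWS**
# (hp-8 g43; the W companion of `KS.bandX_hyps/bandY_hyps`, SkelFrmBParamsFaceFloorsHypsF)

The one-sided glue `KS.floorsX_XFs_FW` / `KS.floorsY_YFs_FW` (SkelFrmBParamsFaceFloorsXY2HFW / YY2HFW) keeps, per face axis, three band rows in the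
contact offset `kE` (the bound on `|z⊥ − (cenS x⊥ + P.faceSh du)|`, DESIGN W): x-face (`⊥ = 1`, creep `P.c 0`, window `bwX`):
`kE + r₁ ≤ 5r₁`, `2(kE + r₁) + 8u₁ + 8 + 2·c₀ ≤ 5r₁`, `2kE + hF₀ − hB₀ + 6u₁ ≤ 2(c₀ + bwX)`; y′-face (`⊥ = 0`, creep `P.c 1`, window `bwY`):
`kE + r₀ ≤ 5r₀`, `kE + r₀ + 8u₀ + 8 + c₁ ≤ 5r₀`, `2(kE + r₀) + 24u₀ + 24 + 2·c₁ ≤ 5r₀`, `2kE + hF₁ − hB₁ + 14u₀ ≤ 2(c₁ + bwY)`.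
This file derives them, for ANY cells `P : PCells2V` with KN's backward room `hB ∥ = 2r⊥` (`fcellsV_hB`), from THREE node-level rows in a contact
slack `A` (pure `ℤ` bookkeeping, `linarith`):
* the CONTACT row `kE ≤ r⊥ + A` — at the node `A := ⌈(hF∥ + 1)/2⌉ + 5Rl + 15` from p1-g18's `kFF₂V_le_lin : kFF₂V ≤ faceExt⊥ + 5Rl + 15` and
  `faceExt⊥ = ⌈(hB∥ + hF∥)/2⌉ = r⊥ + ⌈(hF∥+1)/2⌉` (SkelPhiFaceDataNV §1, DESIGN W) — the one-sided window makes the contact offset `r⊥ + O(hF∥)`, NOT `2r⊥`;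
* the CAP row `2A + 8u₁ + 8 + 2c₀ ≤ r₁` (x) / `2A + 24u₀ + 24 + 2c₁ ≤ r₀` (y′) — stmt's creep caps `P.c ∥ = O(s)` and `hF∥ = c∥ + HF∥·s⊥ + 2` against `r = 40·Kq·u`;
* the WINDOW row `2A + hF₀ + 6u₁ ≤ 2c₀ + 2bwX` (x) / `2A + hF₁ + 14u₀ ≤ 2c₁ + 2bwY` (y′) — the feasibility rows of record (lane 14:34:28Z / 14:57:35Z:
  `ρ₁ + 9s₁ + ε_x ≤ b₁`, `ρ₀ + 14s₀ + ε_y ≤ b₀` at the instance `(76,19 | 5,54)`, `bwX = 13s₁`, `bwY = 69s₀`).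
NON-VACUITY: the three rows are instantiated by the node packager (BTC layers) from p1-g18's `kFF₂V_le_lin`, stmt-g21's `habX_box_V`/`hPRY_V`/`fcellsV_hF_eq_hFRv`
and `NegB.small3_eq`; here they are hypotheses. builds on p205010 (kernel theorem, internal audit signed; external expert review pending) — nothing here uses
p205010; NOTHING is claimed about the open node `SamePDropOfSkeletonFrm₁`.
Lane `prim-bschramm`, seat `prim-hp-8` (gen 43); helper file (`--supports stmt-CriticalPhenomena-4575 --as helper`).
[cite: KozmaNitzan2024, §4 Lemma 11–12 (pp. 21–25)] [cite: MartineauTassion2017, §4.3]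
-/

noncomputable section

open scoped Classical

namespace Summit.CriticalPhenomena.PercolationContinuityZ3.Theorems.Transplant

namespace PCells2V

open Literature.Probability.Percolation.KozmaNitzan.Cells (oth)

variable (P : PCells2V)

/-- **x-face band rows of the one-sided floors** (`⊥ = 1`): from the contact row `kE ≤ r₁ + A`, the cap row `2A + 8u₁ + 8 + 2c₀ ≤ r₁` and the window
row `2A + hF₀ + 6u₁ ≤ 2c₀ + 2bw`, with KN's backward room `hB 0 = 2r₁`: the three hypotheses `hkEr/hkE2/hfwd` of `KS.floorsX_XFs_FW`. [folklore] -/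
theorem bandX_hypsW {kE A u₁ : ℤ} {bw : ℕ} (hB0 : (P.hB 0 : ℤ) = 2 * (P.r 1 : ℤ)) (hu : 0 ≤ u₁) (hkEV : kE ≤ (P.r 1 : ℤ) + A)
    (hcap : 2 * A + 8 * u₁ + 8 + 2 * (P.c 0 : ℤ) ≤ (P.r 1 : ℤ)) (hwin : 2 * A + (P.hF 0 : ℤ) + 6 * u₁ ≤ 2 * (P.c 0 : ℤ) + 2 * (bw : ℤ)) :
    kE + (P.r 1 : ℤ) ≤ 5 * (P.r 1 : ℤ) ∧ 2 * (kE + (P.r 1 : ℤ)) + 8 * u₁ + 8 + 2 * (P.c 0 : ℤ) ≤ 5 * (P.r 1 : ℤ) ∧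
      2 * kE + (P.hF 0 : ℤ) - P.hB 0 + 6 * u₁ ≤ 2 * ((P.c 0 : ℤ) + bw) := by
  have hc : (0 : ℤ) ≤ P.c 0 := P.hc0 0
  refine ⟨by linarith, by linarith, ?_⟩
  rw [hB0]
  linarith

/-- **y′-face band rows of the one-sided floors** (`⊥ = 0`): from the contact row `kE ≤ r₀ + A`, the cap row `2A + 24u₀ + 24 + 2c₁ ≤ r₀` and the window
row `2A + hF₁ + 14u₀ ≤ 2c₁ + 2bw`, with KN's backward room `hB 1 = 2r₀`: the four hypotheses `hkE/hkE8/hkE24/hfwd` of `KS.floorsY_YFs_FW`. [folklore] -/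
theorem bandY_hypsW {kE A u₀ : ℤ} {bw : ℕ} (hB1 : (P.hB 1 : ℤ) = 2 * (P.r 0 : ℤ)) (hu : 0 ≤ u₀) (hkEV : kE ≤ (P.r 0 : ℤ) + A)
    (hcap : 2 * A + 24 * u₀ + 24 + 2 * (P.c 1 : ℤ) ≤ (P.r 0 : ℤ)) (hwin : 2 * A + (P.hF 1 : ℤ) + 14 * u₀ ≤ 2 * (P.c 1 : ℤ) + 2 * (bw : ℤ)) :
    kE + (P.r 0 : ℤ) ≤ 5 * (P.r 0 : ℤ) ∧ kE + (P.r 0 : ℤ) + 8 * u₀ + 8 + P.c 1 ≤ 5 * (P.r 0 : ℤ) ∧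
      2 * (kE + (P.r 0 : ℤ)) + 24 * u₀ + 24 + 2 * (P.c 1 : ℤ) ≤ 5 * (P.r 0 : ℤ) ∧ 2 * kE + (P.hF 1 : ℤ) - P.hB 1 + 14 * u₀ ≤ 2 * ((P.c 1 : ℤ) + bw) := by
  have hc : (0 : ℤ) ≤ P.c 1 := P.hc0 1
  refine ⟨by linarith, by linarith, by linarith, ?_⟩
  rw [hB1]
  linarith

/-- **The contact slack of the one-sided window**: `faceExt⊥`-shaped bound `kE ≤ ⌈(hB∥ + hF∥)/2⌉ + L` with `hB∥ = 2r⊥` gives the contact row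
`kE ≤ r⊥ + A` at `A := (hF∥ + 1)/2 + L`. [folklore] -/
theorem contact_rowW {kE L : ℤ} (I : Fin 2) (hB : (P.hB I : ℤ) = 2 * (P.r (oth I) : ℤ))
    (hk : kE ≤ ((P.hB I : ℤ) + P.hF I + 1) / 2 + L) : kE ≤ (P.r (oth I) : ℤ) + (((P.hF I : ℤ) + 1) / 2 + L) := by
  rw [hB] at hk
  have e : (2 * (P.r (oth I) : ℤ) + P.hF I + 1) / 2 = (P.r (oth I) : ℤ) + ((P.hF I : ℤ) + 1) / 2 := by omega
  rw [e] at hk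
  linarith

end PCells2V

end Summit.CriticalPhenomena.PercolationContinuityZ3.Theorems.Transplant

end
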